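import Summits.QuantumFields.YangMills.Theorems.BalabanUVNodesN12DirectSurjHsurjUniformBPrelim
import HarnessLib

/-!
# BalabanUVNodes ∕ N12 — (P4)′ SUPPORT EDITION WITH THE SUP-NORM LETTER `B` PER HEIGHT: `∃ ε > 0, ∃ B ≥ 0, ∀ (M₁, Z) …` — the constant of the right inverse is chosen BEFORE the instance
# (the «LOCATED-B» quantifier order repaired), by reading the FLAT chart derivative through ONE per-height letter `Λ♭` instead of a per-instance `bound_of_continuous`

Cell `pub-ymgap` (HUMAN RULINGS D-0062 ∕ D-0149), WIDTH SEAT `pub-ymgap-dag-n12-w6` g9 (node N12 = [B15]; key K1⁹ `stmt-QuantumFields-27364`, `--kind proof --supports … --as helper`;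
count-neutral).  THEOREMS ONLY (0 `def`, 0 `instance`, 0 `sorry`).  EDITION of this seat's g8 file `…N12DirectSurjHsurjSupport` (p685568): the statement VERBATIM except that `∃ B, 0 ≤ B ∧`
moves IN FRONT of `∀ M₁ Z`; the proof verbatim except that the flat-derivative letter `Λ₀` (there: `SemilinearMapClass.bound_of_continuous` applied to `DΦ♭_{𝐁_k(Z)}(0)`, the ONLY
instance-dependence of `B`) is replaced by the per-height letter `Λ♭` of `…UniformBPrelim.exists_flatDeriv_letter` (`(DΦ♭_𝐁(0)X)_{(j,c)} = π((Q^{(j)}↑X)(c))`, `‖·‖ ≤ c_π(3(d+2)L)^k‖X‖` for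
EVERY `𝐁`).  So `B = β(k+1)(1+Λβ)^{k+1}`, `β = 1 + 2C_Φ`, `Λ = Λ♭ + C₁ρ₁C_p + 1`, all per height `(F, K, k, N)`.

WHAT IS NOT CLAIMED.  `B`'s VALUE still reads the torus: `C_p = #PBond(F.P K)` (the global seminorm of the (δ₂)♯ component letter, `…HsurjSupportPrelim.exists_cardSeminorm`) and the
compactness constants `C₁ ρ₁ C₂ ρ₂ C_Φ` (per height, existential) — census U4; print's volume-free (46) is NOT claimed.  What changes is the quantifier grade: `B` joins `C ρ K_τ ρ_τ ρ″ M₂`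
as a per-height letter dischargeable BEFORE `ν` ∕ the run's regions.

CONTENTS.  ★★★ `exists_rightInverse_letter_support_uniformB` — `∃ ε > 0, ∃ B ≥ 0, ∀ M₁ ≥ 1, Z, (2.13)-divisibility, W, U₀:` p678596's hypotheses ⟹ `∃ H, hHinv ∧ hHB∞ ∧ hHB ∧ hHsupp″`
(texts as in p685568).

HONEST FRAMING.  Bookkeeping by name over landed kernel theorems (this lineage's p685568 proof re-run with one letter exchanged); per-height EXISTENCE constants; nothing of Bałaban's
asserted or refuted; N12 NOT discharged; K1⁹ NOT closed; count-neutral; R4 closes only the conditional finite-`𝕋⁴` rung `BalabanLadder.UV`; no summit statement is proved here and NOT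
the Yang–Mills mass gap (Clay); nothing continuum ∕ ℝ⁴ ∕ OS.
-/

noncomputable section

open scoped BigOperators Matrix.Norms.L2Operator Topology NNReal
open Filter

namespace Summit.QuantumFields.YangMills.BalabanUVNodes.N12DirectSurjHsurjUniformB

open Literature.MathematicalPhysics.QuantumFieldTheory.Balaban1983to89
open Node00 B15DeterminingSets
open T4Continuum (T4Family)
open BlockAveragingEMLLinearised (linAvg)
open T4AdjointCovarianceUnitary (lieSU)
open B14.Eq213DetSet (Bj maxDomT Bj_of_gt)
open B14.Eq213MaximalDomains (side)
open B14.Eq216Concrete (feeds)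
open B5Eq118OneStroke (iterBlockOf)
open B15Eq112TorusCover (lift)
open T4AxialGaugeSmallField (boxPlaqs)
open Summit.QuantumFields.YangMills.BalabanUVNodes.N12DirectSurjTriangularSupport (exists_rightInverse_bound_support_of_rankwise)
open Summit.QuantumFields.YangMills.BalabanUVNodes.N12DirectSurjHsurjSupportPrelim
open Summit.QuantumFields.YangMills.BalabanUVNodes.N12DirectSurjSiteBlockCurved (exists_rowBound exists_curved_siteBlock)
open Summit.QuantumFields.YangMills.BalabanUVNodes.N12DirectSurjBoxGauge (exists_boxGauge)
open Summit.QuantumFields.YangMills.BalabanUVNodes.N12DirectSurjHsurjPrelim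
open Summit.QuantumFields.YangMills.BalabanUVNodes.N12DirectSurjHsurjProxiesPrelim
open Summit.QuantumFields.YangMills.BalabanUVNodes.N12DirectSurjHsurjUniformBPrelim (exists_flatDeriv_letter)

section Record

variable {F : T4Family} {N : ℕ} [NeZero N] {K k : ℕ}

set_option maxHeartbeats 400000 in
/-- ★★★ **(P4)′, SUPPORT EDITION, `B` PER HEIGHT.**  p685568's `exists_rightInverse_letter_support_of_proxies` with `∃ B, 0 ≤ B` IN FRONT of `∀ M₁ Z`: ONE `ε > 0` and ONE `B ≥ 0` per
height such that, for every `M₁ ≥ 1`, `Z` with (2.13)'s divisibility, `W`, `U₀` in the fibre with the guarded proxies and the box plaquette letter, a right inverse `H` of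
`DΨ_{𝐁_k(Z),W,U₀}(0)` with `‖H v‖ ≤ B‖v‖`, `√(Σ_b ‖H v b‖²) ≤ (√#PBond·B)‖v‖` and the graded support clause `hHsupp″`.  Proof = p685568's, the flat letter `Λ₀` replaced by the per-height
`Λ♭` of `exists_flatDeriv_letter`. [cite: Balaban1985Variational, (83) p.290, (44)-(47) p.285, (153) p.301; Balaban1988Convergent, (2.2) p.255, (2.10)-(2.13) pp.256-257; Balaban1987RG1, (0.4) p.253] -/
theorem exists_rightInverse_letter_support_uniformB (hkK : k + 1 ≤ (F.P K).m + (F.P K).K) :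
    ∃ ε : ℝ, 0 < ε ∧ ∃ B : ℝ, 0 ≤ B ∧ ∀ (M₁ : ℕ) (_ : 1 ≤ M₁) (Z : Set (Site (F.P K) 0)) (_ : side (F.P K).L M₁ k ∣ (F.P K).sitesPerDir 0)
      (W : MSField (F.P K) (SU N)) (U₀ : GaugeField (F.P K) 0 (SU N)),
        AgreeOn (Bj M₁ Z k) (avgFamily (avOfRecord F N K) U₀) W →
        (∀ i : Fin (constrCard (Bj M₁ Z k) k), ∃ U' : GaugeField (F.P K) 0 (SU N),
          (∀ b ∈ feeds (((constrEnum (Bj M₁ Z k) k).symm i).1 : ℕ) ((constrEnum (Bj M₁ Z k) k).symm i).2.1, U' b = U₀ b) ∧ SmallBelow (avOfRecord F N K) k U') →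
        (∀ (j : ℕ), 1 ≤ j → j ≤ k → ∀ y : Site (F.P K) j, embIter j y ∈ maxDomT M₁ Z j → ∃ U' : GaugeField (F.P K) 0 (SU N),
          (∀ c : PBond (F.P K) j, (c.src = y ∨ c.tgt = y) → ∀ b₀ : PBond (F.P K) 0,
            (iterBlockOf j b₀.src = c.src ∨ iterBlockOf j b₀.src = c.tgt) → (iterBlockOf j b₀.tgt = c.src ∨ iterBlockOf j b₀.tgt = c.tgt) → U' b₀ = U₀ b₀) ∧
          SmallBelow (avOfRecord F N K) k U') →
        (∀ (j : ℕ), 1 ≤ j → j ≤ k → ∀ y : Site (F.P K) j, embIter j y ∈ maxDomT M₁ Z j →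
          PlaqSmallOn (boxPlaqs (P := F.P K) (j := 0)
            (fun κ => lift (F.P K) (embIter j y) κ - ((((F.P K).L ^ j : ℕ) : ℤ) + ((((F.P K).L ^ j - 1) / 2 : ℕ) : ℤ)))
            (fun κ => lift (F.P K) (embIter j y) κ + ((((F.P K).L ^ j : ℕ) : ℤ) + ((((F.P K).L ^ j - 1) / 2 : ℕ) : ℤ)))) ε U₀) →
        ∃ H : (Fin (constrCard (Bj M₁ Z k) k) → lieSU (Fin N)) → PBond (F.P K) 0 → lieSU (Fin N),
          (∀ v, fderiv ℝ (msChart F N K k (Bj M₁ Z k) W U₀) 0 (H v) = v) ∧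
          (∀ v, ‖H v‖ ≤ B * ‖v‖) ∧
          (∀ v, Real.sqrt (∑ b, ‖H v b‖ ^ 2) ≤ (Real.sqrt (Fintype.card (PBond (F.P K) 0)) * B) * ‖v‖) ∧
          ∀ (v : Fin (constrCard (Bj M₁ Z k) k) → lieSU (Fin N)) (𝒮 : ℕ → Set (PBond (F.P K) 0)),
            (∀ (b : PBond (F.P K) 0) (hb : b ∈ bondsOf (Bj M₁ Z k 0)), v (constrEnum (Bj M₁ Z k) k ⟨⟨0, Nat.succ_pos k⟩, b, hb⟩) ≠ 0 → b ∈ 𝒮 0) →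
            (∀ (j : ℕ) (hj : 1 ≤ j) (hjk : j ≤ k) (c : PBond (F.P K) j) (hc : c ∈ bondsOf (Bj M₁ Z k j)),
              (v (constrEnum (Bj M₁ Z k) k ⟨⟨j, Nat.lt_succ_of_le hjk⟩, c, hc⟩) ≠ 0 ∨
                ∃ m, m < j ∧ ∃ b₀ ∈ 𝒮 m, (iterBlockOf j b₀.src = c.src ∨ iterBlockOf j b₀.src = c.tgt) ∧ (iterBlockOf j b₀.tgt = c.src ∨ iterBlockOf j b₀.tgt = c.tgt)) →
              ∀ y : Site (F.P K) j, (c.src = y ∨ c.tgt = y) → embIter j y ∈ maxDomT M₁ Z j →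
              ∀ b₀ : PBond (F.P K) 0, iterBlockOf j b₀.src = y → iterBlockOf j b₀.tgt = y → iterBlockOf (j - 1) b₀.src ≠ iterBlockOf (j - 1) b₀.tgt → b₀ ∈ 𝒮 j) →
            ∀ b, (∀ m, b ∉ 𝒮 m) → H v b = 0 := by
  classical
  have hk : k ≤ (F.P K).m + (F.P K).K := Nat.le_of_succ_le hkK
  obtain ⟨Q, hQ0, hQs⟩ : ∃ Q : (i : ℕ) → (PBond (F.P K) 0 → Matrix (Fin N) (Fin N) ℂ) → PBond (F.P K) i → Matrix (Fin N) (Fin N) ℂ,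
      (∀ Y, Q 0 Y = Y) ∧ ∀ (i : ℕ) (Y : PBond (F.P K) 0 → Matrix (Fin N) (Fin N) ℂ) (c : PBond (F.P K) (i + 1)), Q (i + 1) Y c = linAvg (Q i Y) c :=
    ⟨fun i => Nat.rec (motive := fun i => (PBond (F.P K) 0 → Matrix (Fin N) (Fin N) ℂ) → PBond (F.P K) i → Matrix (Fin N) (Fin N) ℂ) (fun Y => Y)
      (fun _ Qi Y c => linAvg (Qi Y) c) i, fun _ => rfl, fun _ _ _ => rfl⟩
  obtain ⟨p, Cp, hCp, hp, hpn⟩ := exists_cardSeminorm (F := F) K N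
  obtain ⟨C₁, ρ₁, hC₁, hρ₁, hRB⟩ := exists_rowBound (F := F) (N := N) (K := K) k Q hQ0 hQs p hp hCp hpn
  obtain ⟨C₂, ρ₂, hC₂, hρ₂, hblk⟩ := exists_curved_siteBlock (F := F) (N := N) (K := K) k Q hQ0 hQs p hp hCp hpn
  obtain ⟨Φf, CΦ, hCΦ1, hCΦfn, hΦprops⟩ := exists_flatBlocks_uniform (F := F) (N := N) (K := K) k Q hQ0 hQs
  have hCΦ0 : 0 ≤ CΦ := zero_le_one.trans hCΦ1
  set D : ℝ := (((F.P K).d - 1 : ℕ) : ℝ) * ((2 * ((F.P K).L ^ k + ((F.P K).L ^ k - 1) / 2) : ℕ) : ℝ) with hD_def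
  have hD0 : 0 ≤ D := mul_nonneg (Nat.cast_nonneg _) (Nat.cast_nonneg _)
  have hDj : ∀ j ≤ k, (((F.P K).d - 1 : ℕ) : ℝ) * ((2 * ((F.P K).L ^ j + ((F.P K).L ^ j - 1) / 2) : ℕ) : ℝ) ≤ D := fun j hj => by
    rw [hD_def]
    refine mul_le_mul_of_nonneg_left ?_ (Nat.cast_nonneg _)
    have h1 : (F.P K).L ^ j ≤ (F.P K).L ^ k := Nat.pow_le_pow_right (F.P K).L_pos hj
    have h2 : ((F.P K).L ^ j - 1) / 2 ≤ ((F.P K).L ^ k - 1) / 2 := Nat.div_le_div_right (by omega)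
    exact_mod_cast (by omega : 2 * ((F.P K).L ^ j + ((F.P K).L ^ j - 1) / 2) ≤ 2 * ((F.P K).L ^ k + ((F.P K).L ^ k - 1) / 2))
  set ρ : ℝ := min ρ₁ ρ₂ with hρ_def
  have hρ : 0 < ρ := lt_min hρ₁ hρ₂
  obtain ⟨ε, hε, hDε, hDεC⟩ := exists_threshold hC₂ hCp hCΦ0 hρ hD0
  -- the per-height letters: flat derivative `Λ♭`, row bound `Λ`, block letter `β`, and `B` — BEFORE the instance
  obtain ⟨Λf, hΛf0, hΛf⟩ := exists_flatDeriv_letter (F := F) (N := N) K k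
  set Λ : ℝ := Λf + C₁ * ρ₁ * Cp + 1 with hΛ_def
  have hΛ1 : 1 ≤ Λ := by rw [hΛ_def]; nlinarith [mul_nonneg (mul_nonneg hC₁ hρ₁.le) hCp]
  have hΛ0 : 0 ≤ Λ := zero_le_one.trans hΛ1
  set β : ℝ := 1 + 2 * CΦ with hβ_def
  have hβ0 : 0 ≤ β := by rw [hβ_def]; linarith
  have hβ1 : 1 ≤ β := by rw [hβ_def]; linarith
  set Nr : ℕ := k + 1 with hNr_def
  refine ⟨ε, hε, β * Nr * (1 + Λ * β) ^ Nr, mul_nonneg (mul_nonneg hβ0 (Nat.cast_nonneg _)) (pow_nonneg (add_nonneg zero_le_one (mul_nonneg hΛ0 hβ0)) _),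
    fun M₁ hM1 Z hdiv W U₀ hU hprox hproxSite hplaq => ?_⟩
  have h𝔹 : ∀ j, k < j → Bj M₁ Z k j = ∅ := fun j hj => Bj_of_gt hj
  -- (1) per instance: inner sites, hosts; ranks = LEVELS; towers and columns
  let inner : (j : ℕ) → Site (F.P K) j → Prop := fun j y => embIter j y ∈ maxDomT M₁ Z j
  have hhost := fun j => exists_host (inner j) (fun _ : Site (F.P K) j => (0 : ℕ))
  choose hostF hostF_mem hostF_inner _hostF_max using hhost
  let host : (j : ℕ) → PBond (F.P K) j → Site (F.P K) j := fun j c => hostF j c.src c.tgt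
  have host_mem : ∀ j (c : PBond (F.P K) j), host j c = c.src ∨ host j c = c.tgt := fun j c => hostF_mem j c.src c.tgt
  have host_inner : ∀ j (c : PBond (F.P K) j), (inner j c.src ∨ inner j c.tgt) → inner j (host j c) := fun j c h => hostF_inner j c.src c.tgt h
  have host_touch : ∀ j (c : PBond (F.P K) j), c.src = host j c ∨ c.tgt = host j c := fun j c =>
    (host_mem j c).elim (fun h => Or.inl h.symm) (fun h => Or.inr h.symm)
  obtain ⟨rank, hrank⟩ : ∃ rank : Fin (constrCard (Bj M₁ Z k) k) → ℕ, ∀ (j' : ℕ) (hj' : j' < k + 1) (c' : PBond (F.P K) j') (hc' : c' ∈ bondsOf (Bj M₁ Z k j')),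
      rank (constrEnum (Bj M₁ Z k) k ⟨⟨j', hj'⟩, c', hc'⟩) = j' :=
    ⟨fun i => (((constrEnum (Bj M₁ Z k) k).symm i).1 : ℕ), fun j' hj' c' hc' => by simp only [Equiv.symm_apply_apply]⟩
  let tw : ConstrSet (Bj M₁ Z k) k → Set (PBond (F.P K) 0) := fun s =>
    if ((s.1 : ℕ)) = 0 then {b₀ | (⟨(s.1 : ℕ), s.2.1⟩ : (j : ℕ) × PBond (F.P K) j) = ⟨0, b₀⟩} else
      {b₀ | (iterBlockOf (s.1 : ℕ) b₀.src = s.2.1.src ∨ iterBlockOf (s.1 : ℕ) b₀.src = s.2.1.tgt) ∧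
        (iterBlockOf (s.1 : ℕ) b₀.tgt = s.2.1.src ∨ iterBlockOf (s.1 : ℕ) b₀.tgt = s.2.1.tgt)}
  let cl : ConstrSet (Bj M₁ Z k) k → Set (PBond (F.P K) 0) := fun s =>
    if ((s.1 : ℕ)) = 0 then {b₀ | (⟨(s.1 : ℕ), s.2.1⟩ : (j : ℕ) × PBond (F.P K) j) = ⟨0, b₀⟩} else
      {b₀ | iterBlockOf (s.1 : ℕ) b₀.src = host s.1 s.2.1 ∧ iterBlockOf (s.1 : ℕ) b₀.tgt = host s.1 s.2.1 ∧
        iterBlockOf ((s.1 : ℕ) - 1) b₀.src ≠ iterBlockOf ((s.1 : ℕ) - 1) b₀.tgt}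
  obtain ⟨tower, htower⟩ : ∃ tower : Fin (constrCard (Bj M₁ Z k) k) → Set (PBond (F.P K) 0), ∀ (j' : ℕ) (hj' : j' < k + 1) (c' : PBond (F.P K) j')
      (hc' : c' ∈ bondsOf (Bj M₁ Z k j')), tower (constrEnum (Bj M₁ Z k) k ⟨⟨j', hj'⟩, c', hc'⟩) = if j' = 0 then {b₀ | (⟨j', c'⟩ : (j : ℕ) × PBond (F.P K) j) = ⟨0, b₀⟩} else
        {b₀ | (iterBlockOf j' b₀.src = c'.src ∨ iterBlockOf j' b₀.src = c'.tgt) ∧ (iterBlockOf j' b₀.tgt = c'.src ∨ iterBlockOf j' b₀.tgt = c'.tgt)} :=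
    ⟨fun i => tw ((constrEnum (Bj M₁ Z k) k).symm i), fun j' hj' c' hc' => congrArg tw ((constrEnum (Bj M₁ Z k) k).symm_apply_apply ⟨⟨j', hj'⟩, c', hc'⟩)⟩
  obtain ⟨col, hcol⟩ : ∃ col : Fin (constrCard (Bj M₁ Z k) k) → Set (PBond (F.P K) 0), ∀ (j' : ℕ) (hj' : j' < k + 1) (c' : PBond (F.P K) j')
      (hc' : c' ∈ bondsOf (Bj M₁ Z k j')), col (constrEnum (Bj M₁ Z k) k ⟨⟨j', hj'⟩, c', hc'⟩) = if j' = 0 then {b₀ | (⟨j', c'⟩ : (j : ℕ) × PBond (F.P K) j) = ⟨0, b₀⟩} else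
        {b₀ | iterBlockOf j' b₀.src = host j' c' ∧ iterBlockOf j' b₀.tgt = host j' c' ∧ iterBlockOf (j' - 1) b₀.src ≠ iterBlockOf (j' - 1) b₀.tgt} :=
    ⟨fun i => cl ((constrEnum (Bj M₁ Z k) k).symm i), fun j' hj' c' hc' => congrArg cl ((constrEnum (Bj M₁ Z k) k).symm_apply_apply ⟨⟨j', hj'⟩, c', hc'⟩)⟩
  have hΨ : DifferentiableAt ℝ (msChart F N K k (Bj M₁ Z k) W U₀) 0 := differentiableAt_msChart_of_towerProxies hk hU hprox
  -- (2) the box gauge at an inner site; the linear map `L = DΨ(0)`, its uniform row bound `Λ`, its row locality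
  have hgauge : ∀ (j : ℕ), 1 ≤ j → j ≤ k → ∀ y : Site (F.P K) j, inner j y →
      ∃ u : GaugeTransf (F.P K) 0 (SU N), ∀ (c : PBond (F.P K) j), (c.src = y ∨ c.tgt = y) → ∀ b₀ : PBond (F.P K) 0,
        (iterBlockOf j b₀.src = c.src ∨ iterBlockOf j b₀.src = c.tgt) → (iterBlockOf j b₀.tgt = c.src ∨ iterBlockOf j b₀.tgt = c.tgt) →
        ‖((GaugeField.gaugeAct u U₀ b₀ : SU N) : Matrix (Fin N) (Fin N) ℂ) - 1‖ ≤ D * ε := by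
    intro j hj1 hjk y hy
    obtain ⟨u, hu⟩ := exists_boxGauge (P := F.P K) (N := N) (hjk.trans hk) (three_mul_pow_lt_sitesPerDir hkK hjk) y U₀ hε.le (hplaq j hj1 hjk y hy)
    exact ⟨u, fun c hc b₀ hs ht => (hu b₀ (near_of_endpoint c hc _ hs) (near_of_endpoint c hc _ ht)).trans
      (mul_le_mul_of_nonneg_right (hDj j hjk) hε.le)⟩
  have hDερ₁ : D * ε < ρ₁ := hDε.trans_le (min_le_left _ _)
  have hDερ₂ : D * ε < ρ₂ := hDε.trans_le (min_le_right _ _)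
  have hDε0 : 0 ≤ D * ε := mul_nonneg hD0 hε.le
  set L : (PBond (F.P K) 0 → lieSU (Fin N)) →ₗ[ℝ] (Fin (constrCard (Bj M₁ Z k) k) → lieSU (Fin N)) :=
    (fderiv ℝ (msChart F N K k (Bj M₁ Z k) W U₀) 0).toLinearMap with hL_def
  have hLapp : ∀ x i, L x i = fderiv ℝ (msChart F N K k (Bj M₁ Z k) W U₀) 0 x i := fun _ _ => rfl
  have hrow : ∀ (s : ConstrSet (Bj M₁ Z k) k) (x : PBond (F.P K) 0 → lieSU (Fin N)),
      ‖fderiv ℝ (msChart F N K k (Bj M₁ Z k) W U₀) 0 x (constrEnum (Bj M₁ Z k) k s)‖ ≤ Λ * ‖x‖ := by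
    rintro ⟨⟨j', hj'⟩, c', hc'⟩ x
    have hj'k : j' ≤ k := Nat.lt_succ_iff.1 hj'
    rcases Nat.eq_zero_or_pos j' with rfl | hpos
    · rw [fderiv_msChart_apply_levelZero hU hΨ c' hc' x]
      exact (norm_le_pi_norm x c').trans (le_mul_of_one_le_left (norm_nonneg _) hΛ1)
    · have hin : inner j' (host j' c') := host_inner j' c' (inner_endpoint_of_mem_bondsOf_Bj hpos hj'k hc')
      obtain ⟨u, hu⟩ := hgauge j' hpos hj'k (host j' c') hin
      have hcy : c'.src = host j' c' ∨ c'.tgt = host j' c' := host_touch j' c'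
      have hflat := hu c' hcy
      -- the guarded proxy at the host site, in its own fibre
      obtain ⟨U', hag, hsb'⟩ := hproxSite j' hpos hj'k (host j' c') hin
      have hflat' : ∀ b₀ : PBond (F.P K) 0, (iterBlockOf j' b₀.src = c'.src ∨ iterBlockOf j' b₀.src = c'.tgt) →
          (iterBlockOf j' b₀.tgt = c'.src ∨ iterBlockOf j' b₀.tgt = c'.tgt) →
          ‖((GaugeField.gaugeAct u U' b₀ : SU N) : Matrix (Fin N) (Fin N) ℂ) - 1‖ ≤ D * ε := fun b₀ hs ht => by
        have e : GaugeField.gaugeAct u U' b₀ = GaugeField.gaugeAct u U₀ b₀ := by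
          show u b₀.src * U' b₀ * (u b₀.tgt)⁻¹ = u b₀.src * U₀ b₀ * (u b₀.tgt)⁻¹
          rw [hag c' hcy b₀ hs ht]
        rw [e]; exact hflat b₀ hs ht
      have h := hRB (Bj M₁ Z k) h𝔹 hk (avgFamily (avOfRecord F N K) U') U' (fun _ _ _ => rfl) hsb' (constrEnum (Bj M₁ Z k) k ⟨⟨j', hj'⟩, c', hc'⟩) u hDε0 hDερ₁
      rw [Equiv.symm_apply_apply] at h
      have htr := fderiv_msChart_apply_eq_of_sharpProxy hk hU hΨ hsb' (constrEnum (Bj M₁ Z k) k ⟨⟨j', hj'⟩, c', hc'⟩)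
        (by rw [Equiv.symm_apply_apply]; exact fun b₀ hs ht => hag c' hcy b₀ hs ht) x
      rw [htr]
      refine (h hflat' hΛf0 (hΛf (Bj M₁ Z k)) x).trans (mul_le_mul_of_nonneg_right ?_ (norm_nonneg _))
      rw [hΛ_def]
      have : C₁ * (D * ε) * Cp ≤ C₁ * ρ₁ * Cp := mul_le_mul_of_nonneg_right (mul_le_mul_of_nonneg_left hDερ₁.le hC₁) hCp
      linarith
  have hLbound : ∀ x, ‖L x‖ ≤ Λ * ‖x‖ := fun x =>
    (pi_norm_le_iff_of_nonneg (mul_nonneg hΛ0 (norm_nonneg _))).2 fun i => by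
      obtain ⟨s, rfl⟩ := (constrEnum (Bj M₁ Z k) k).surjective i
      rw [hLapp]
      exact hrow s x
  have hNr : ∀ i, rank i < Nr := fun i => by
    obtain ⟨⟨⟨j', hj'⟩, c', hc'⟩, rfl⟩ := (constrEnum (Bj M₁ Z k) k).surjective i
    rw [hrank, hNr_def]
    exact hj'
  have hloc : ∀ (x : PBond (F.P K) 0 → lieSU (Fin N)) (i : Fin (constrCard (Bj M₁ Z k) k)), (∀ b ∈ tower i, x b = 0) → L x i = 0 := by
    intro x i hx
    obtain ⟨⟨⟨j', hj'⟩, c', hc'⟩, rfl⟩ := (constrEnum (Bj M₁ Z k) k).surjective i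
    rw [htower] at hx
    rw [hLapp]
    by_cases h0 : j' = 0
    · subst h0
      rw [if_pos rfl] at hx
      rw [fderiv_msChart_apply_levelZero hU hΨ c' hc' x]
      exact hx c' (by rw [Set.mem_setOf_eq])
    · rw [if_neg h0] at hx
      have key := fderiv_msChart_apply_eq_zero_of_vanish_sharp' hk hΨ x (constrEnum (Bj M₁ Z k) k ⟨⟨j', hj'⟩, c', hc'⟩)
      rw [Equiv.symm_apply_apply] at key
      exact key fun b₀ hs ht => hx b₀ (by rw [Set.mem_setOf_eq]; exact ⟨hs, ht⟩)
  -- (3) rank-wise (= LEVEL-wise) solvability with column supports; the level's direction is the SUM of the site solutions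
  have hinj : ∀ (j : ℕ), j ≤ (F.P K).m + (F.P K).K → ∀ q q' : Site (F.P K) j, embIter j q = embIter j q' → q = q' := fun j hj q q' h => by
    rw [← iterBlockOf_embIter j hj q, h, iterBlockOf_embIter j hj q']
  have hsolv : ∀ (r : ℕ) (v : Fin (constrCard (Bj M₁ Z k) k) → lieSU (Fin N)), (∀ i, rank i ≠ r → v i = 0) →
      ∃ x : PBond (F.P K) 0 → lieSU (Fin N), (∀ i, rank i = r → L x i = v i) ∧ (∀ i, rank i < r → L x i = 0) ∧ ‖x‖ ≤ β * ‖v‖ ∧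
        (∀ b, x b ≠ 0 → ∃ i, rank i = r ∧ v i ≠ 0 ∧ b ∈ col i) := by
    intro r v _hv
    rcases Nat.eq_zero_or_pos r with rfl | hrpos
    · -- rank 0: the level-0 rows, hit by the identity placement
      obtain ⟨x, hx_def, hx_off, hxn⟩ := exists_placement (bondsOf (Bj M₁ Z k 0)) (fun b hb => constrEnum (Bj M₁ Z k) k ⟨⟨0, Nat.succ_pos k⟩, b, hb⟩) v
      refine ⟨x, fun i hi => ?_, fun i hi => absurd hi (Nat.not_lt_zero _), hxn.trans (le_mul_of_one_le_left (norm_nonneg _) hβ1), fun b hb => ?_⟩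
      · obtain ⟨⟨⟨j', hj'⟩, c', hc'⟩, rfl⟩ := (constrEnum (Bj M₁ Z k) k).surjective i
        rw [hrank] at hi
        subst hi
        rw [hLapp, fderiv_msChart_apply_levelZero hU hΨ c' hc' x, hx_def c' hc']
      · have hbm : b ∈ bondsOf (Bj M₁ Z k 0) := by
          by_contra hbm
          exact hb (hx_off b hbm)
        refine ⟨constrEnum (Bj M₁ Z k) k ⟨⟨0, Nat.succ_pos k⟩, b, hbm⟩, hrank 0 _ b hbm, by rwa [hx_def b hbm] at hb, ?_⟩
        rw [hcol, if_pos rfl, Set.mem_setOf_eq]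
    · by_cases hrk : r ≤ k
      · -- rank `n + 1 ≤ k`: the SUM of the curved site blocks at the inner `(n+1)`-sites
        obtain ⟨n, rfl⟩ : ∃ n, r = n + 1 := ⟨r - 1, by omega⟩
        have hn : n + 1 ≤ k := hrk
        have hnK : n + 1 ≤ (F.P K).m + (F.P K).K := hn.trans hk
        -- per-site solutions: the curved block at an inner site on the truncated target hosted there, zero elsewhere
        have hsite : ∀ y : Site (F.P K) (n + 1), ∃ X : PBond (F.P K) 0 → lieSU (Fin N),
            ‖X‖ ≤ 2 * CΦ * ‖v‖ ∧
            (∀ b : PBond (F.P K) 0, X b ≠ 0 → iterBlockOf (n + 1) b.src = y ∧ iterBlockOf (n + 1) b.tgt = y ∧ iterBlockOf n b.src ≠ iterBlockOf n b.tgt ∧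
              ∃ (c : PBond (F.P K) (n + 1)) (hc : c ∈ bondsOf (Bj M₁ Z k (n + 1))), host (n + 1) c = y ∧
                v (constrEnum (Bj M₁ Z k) k ⟨⟨n + 1, Nat.lt_succ_of_le hn⟩, c, hc⟩) ≠ 0) ∧
            (inner (n + 1) y → ∀ (c : PBond (F.P K) (n + 1)) (hc : c ∈ bondsOf (Bj M₁ Z k (n + 1))), (c.src = y ∨ c.tgt = y) →
              L X (constrEnum (Bj M₁ Z k) k ⟨⟨n + 1, Nat.lt_succ_of_le hn⟩, c, hc⟩) =
                if host (n + 1) c = y then v (constrEnum (Bj M₁ Z k) k ⟨⟨n + 1, Nat.lt_succ_of_le hn⟩, c, hc⟩) else 0) ∧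
            (¬ inner (n + 1) y → X = 0) := by
          intro y
          by_cases hy : inner (n + 1) y
          · obtain ⟨hΦQ, hΦsupp⟩ := hΦprops n y hnK
            obtain ⟨u, hu⟩ := hgauge (n + 1) (Nat.succ_pos n) hn y hy
            -- the guarded proxy at the site, in its own fibre; the box gauge is as flat on it
            obtain ⟨U', hag, hsb'⟩ := hproxSite (n + 1) (Nat.succ_pos n) hn y hy
            have hu' : ∀ c : PBond (F.P K) (n + 1), (c.src = y ∨ c.tgt = y) → ∀ b₀ : PBond (F.P K) 0,
                (iterBlockOf (n + 1) b₀.src = c.src ∨ iterBlockOf (n + 1) b₀.src = c.tgt) →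
                (iterBlockOf (n + 1) b₀.tgt = c.src ∨ iterBlockOf (n + 1) b₀.tgt = c.tgt) →
                ‖((GaugeField.gaugeAct u U' b₀ : SU N) : Matrix (Fin N) (Fin N) ℂ) - 1‖ ≤ D * ε := fun c hc b₀ hs ht => by
              have e : GaugeField.gaugeAct u U' b₀ = GaugeField.gaugeAct u U₀ b₀ := by
                show u b₀.src * U' b₀ * (u b₀.tgt)⁻¹ = u b₀.src * U₀ b₀ * (u b₀.tgt)⁻¹
                rw [hag c hc b₀ hs ht]
              rw [e]; exact hu c hc b₀ hs ht
            -- the truncated target hosted at `y`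
            obtain ⟨t, ht_def, htn, ht_ne⟩ := exists_truncTarget (bondsOf (Bj M₁ Z k (n + 1)))
              (fun c hc => constrEnum (Bj M₁ Z k) k ⟨⟨n + 1, Nat.lt_succ_of_le hn⟩, c, hc⟩) (host (n + 1)) y v
            obtain ⟨X, hXrows, hXsupp, hXn⟩ := hblk (Bj M₁ Z k) h𝔹 hk (avgFamily (avOfRecord F N K) U') U' (fun _ _ _ => rfl) hsb' hn y (Φf n y) hCΦ0 hΦQ
              (hCΦfn n (Nat.lt_of_succ_le hn) y) u hDε0 hDερ₂ hDεC hu' t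
            have hXsupp' : ∀ b : PBond (F.P K) 0, X b ≠ 0 →
                iterBlockOf (n + 1) b.src = y ∧ iterBlockOf (n + 1) b.tgt = y ∧ iterBlockOf n b.src ≠ iterBlockOf n b.tgt := fun b hb => by
              obtain ⟨w, hw⟩ := hXsupp b hb
              exact hΦsupp w b hw
            have htne : (∃ b : PBond (F.P K) 0, X b ≠ 0) → t ≠ 0 := by
              rintro ⟨b, hb⟩ rfl
              rw [norm_zero, mul_zero] at hXn
              exact hb (by rw [norm_le_zero_iff.1 hXn]; rfl)
            refine ⟨X, hXn.trans ?_, fun b hb => ?_, fun _ c hc hcy => ?_, fun h => absurd hy h⟩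
            · exact mul_le_mul_of_nonneg_left htn (by positivity)
            · obtain ⟨h1, h2, h3⟩ := hXsupp' b hb
              obtain ⟨c, hc, hhost, hvc⟩ := ht_ne (htne ⟨b, hb⟩)
              exact ⟨h1, h2, h3, c, hc, hhost, hvc⟩
            · rw [hLapp, fderiv_msChart_apply_eq_of_sharpProxy hk hU hΨ hsb' (constrEnum (Bj M₁ Z k) k ⟨⟨n + 1, Nat.lt_succ_of_le hn⟩, c, hc⟩)
                (by rw [Equiv.symm_apply_apply]; exact fun b₀ hs ht => hag c hcy b₀ hs ht) X, hXrows c hc hcy, ht_def c hc]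
          · refine ⟨0, ?_, fun b hb => absurd rfl hb, fun h => absurd h hy, fun _ => rfl⟩
            rw [norm_zero]; positivity
        choose Xs hXsn hXsupp hXrows hXzero using hsite
        set x : PBond (F.P K) 0 → lieSU (Fin N) := ∑ y : Site (F.P K) (n + 1), Xs y with hx_def
        have hx_apply : ∀ b : PBond (F.P K) 0, x b = Xs (iterBlockOf (n + 1) b.src) b := fun b => by
          rw [hx_def]; exact sum_apply_eq_of_support (fun b : PBond (F.P K) 0 => iterBlockOf (n + 1) b.src) Xs (fun y b hb => (hXsupp y b hb).1) b
        -- the footprint of one site solution on the rows of level `≤ n` and on the level-`(n+1)` rows not touching its site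
        have hfoot : ∀ (y : Site (F.P K) (n + 1)) (j' : ℕ) (hj' : j' < k + 1) (c' : PBond (F.P K) j') (hc' : c' ∈ bondsOf (Bj M₁ Z k j')),
            (j' ≤ n ∨ (j' = n + 1 ∧ embIter j' c'.src ≠ embIter (n + 1) y ∧ embIter j' c'.tgt ≠ embIter (n + 1) y)) →
            L (Xs y) (constrEnum (Bj M₁ Z k) k ⟨⟨j', hj'⟩, c', hc'⟩) = 0 := by
          intro y j' hj' c' hc' hjc
          by_cases hy : inner (n + 1) y
          · have hfp := fderiv_msChart_apply_eq_zero_of_siteSupport' (F := F) hM1 hdiv hk hΨ hn hy (Xs y)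
              (fun b hb => ⟨(hXsupp y b hb).1, (hXsupp y b hb).2.1, (hXsupp y b hb).2.2.1⟩) (constrEnum (Bj M₁ Z k) k ⟨⟨j', hj'⟩, c', hc'⟩)
            rw [Equiv.symm_apply_apply] at hfp
            rw [hLapp]
            exact hfp hjc
          · rw [hXzero y hy, map_zero]; rfl
        refine ⟨x, fun i hi => ?_, fun i hi => ?_, ?_, fun b hb => ?_⟩
        · -- rows of rank `n + 1`: exactly the host's block contributes
          obtain ⟨⟨⟨j', hj'⟩, c', hc'⟩, rfl⟩ := (constrEnum (Bj M₁ Z k) k).surjective i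
          rw [hrank] at hi
          subst hi
          have hin : inner (n + 1) (host (n + 1) c') := host_inner _ c' (inner_endpoint_of_mem_bondsOf_Bj (Nat.succ_pos n) hn hc')
          rw [hx_def, map_sum, Finset.sum_apply, Finset.sum_eq_single (host (n + 1) c')]
          · rw [hXrows (host (n + 1) c') hin c' hc' (host_touch _ c'), if_pos rfl]
          · intro y _ hne
            by_cases hy : inner (n + 1) y
            · by_cases hcy : c'.src = y ∨ c'.tgt = y
              · rw [hXrows y hy c' hc' hcy, if_neg (Ne.symm hne)]
              · exact hfoot y (n + 1) hj' c' hc' (Or.inr ⟨rfl, fun hs => hcy (Or.inl (hinj (n + 1) hnK _ _ hs)), fun ht => hcy (Or.inr (hinj (n + 1) hnK _ _ ht))⟩)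
            · rw [hXzero y hy, map_zero]; rfl
          · intro h; exact absurd (Finset.mem_univ _) h
        · -- rows of smaller rank: level `≤ n`, every site solution is invisible
          obtain ⟨⟨⟨j', hj'⟩, c', hc'⟩, rfl⟩ := (constrEnum (Bj M₁ Z k) k).surjective i
          rw [hrank] at hi
          rw [hx_def, map_sum, Finset.sum_apply]
          exact Finset.sum_eq_zero fun y _ => hfoot y j' hj' c' hc' (Or.inl (Nat.lt_succ_iff.1 hi))
        · -- the letter: disjoint supports, so the sup norm of the sum is a sup of the blocks' norms
          refine (pi_norm_le_iff_of_nonneg (mul_nonneg hβ0 (norm_nonneg v))).2 fun b => ?_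
          rw [hx_apply b]
          refine (norm_le_pi_norm _ b).trans ((hXsn _).trans ?_)
          rw [hβ_def]
          nlinarith [norm_nonneg v, hCΦ0]
        · -- the column support
          rw [hx_apply b] at hb
          obtain ⟨h1, h2, h3, c, hc, hhost, hvc⟩ := hXsupp _ b hb
          refine ⟨constrEnum (Bj M₁ Z k) k ⟨⟨n + 1, Nat.lt_succ_of_le hn⟩, c, hc⟩, hrank _ _ c hc, hvc, ?_⟩
          rw [hcol, if_neg (Nat.succ_ne_zero n), Set.mem_setOf_eq, hhost, Nat.add_sub_cancel]
          exact ⟨h1, h2, h3⟩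
      · -- no row has rank `r > k`: `x = 0`
        refine ⟨0, fun i hi => ?_, fun i _ => by rw [map_zero]; rfl, by rw [norm_zero]; exact mul_nonneg hβ0 (norm_nonneg _),
          fun b hb => absurd rfl hb⟩
        exfalso
        obtain ⟨⟨⟨j', hj'⟩, c', hc'⟩, rfl⟩ := (constrEnum (Bj M₁ Z k) k).surjective i
        rw [hrank] at hi
        omega
  -- (4) back-substitution with supports, the norm conversion, and the support clause in the record's vocabulary
  obtain ⟨H, hHinv, hHB, hHS⟩ := exists_rightInverse_bound_support_of_rankwise L rank hNr tower col hβ0 hΛ0 hLbound hloc hsolv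
  refine ⟨H, fun v => ?_, hHB, fun v => ?_, fun v 𝒮 hzero hpos b hb => ?_⟩
  · have h := hHinv v
    rwa [hL_def, ContinuousLinearMap.coe_coe] at h
  · refine (sqrt_sum_sq_le (H v)).trans ?_
    rw [mul_assoc]; exact mul_le_mul_of_nonneg_left (hHB v) (Real.sqrt_nonneg _)
  · refine hHS v 𝒮 (fun i hi => ?_) b hb
    obtain ⟨⟨⟨j', hj'⟩, c', hc'⟩, rfl⟩ := (constrEnum (Bj M₁ Z k) k).surjective i
    rw [htower, hrank] at hi
    rw [hcol, hrank]
    by_cases h0 : j' = 0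
    · subst h0
      rw [if_pos rfl] at hi
      rw [if_pos rfl]
      intro b₀ hb₀
      rw [Set.mem_setOf_eq, sigma_mk_zero_eq_iff] at hb₀
      subst hb₀
      rcases hi with hv | ⟨m, hm, _⟩
      · exact hzero c' hc' hv
      · exact absurd hm (Nat.not_lt_zero m)
    · have hj1 : 1 ≤ j' := Nat.one_le_iff_ne_zero.2 h0
      have hj'k : j' ≤ k := Nat.lt_succ_iff.1 hj'
      rw [if_neg h0] at hi
      rw [if_neg h0]
      intro b₀ hb₀
      rw [Set.mem_setOf_eq] at hb₀
      obtain ⟨hs, ht, hface⟩ := hb₀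
      have hin : inner j' (host j' c') := host_inner j' c' (inner_endpoint_of_mem_bondsOf_Bj hj1 hj'k hc')
      have hi' : v (constrEnum (Bj M₁ Z k) k ⟨⟨j', Nat.lt_succ_of_le hj'k⟩, c', hc'⟩) ≠ 0 ∨
          ∃ m, m < j' ∧ ∃ b₁ ∈ 𝒮 m, (iterBlockOf j' b₁.src = c'.src ∨ iterBlockOf j' b₁.src = c'.tgt) ∧ (iterBlockOf j' b₁.tgt = c'.src ∨ iterBlockOf j' b₁.tgt = c'.tgt) := by
        rcases hi with hv | ⟨m, hm, b₁, hb₁S, hb₁t⟩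
        · exact Or.inl hv
        · exact Or.inr ⟨m, hm, b₁, hb₁S, by rwa [Set.mem_setOf_eq] at hb₁t⟩
      exact hpos j' hj1 hj'k c' hc' hi' (host j' c') (host_touch j' c') hin b₀ hs ht hface

end Record

end Summit.QuantumFields.YangMills.BalabanUVNodes.N12DirectSurjHsurjUniformB

end
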